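import Literature.Analysis.FluidPDE.TaoAveragedQuaternionRotation
import Mathlib.Analysis.SpecialFunctions.PolarCoord
import Mathlib.MeasureTheory.Function.JacobianOneDim
import Mathlib.MeasureTheory.Measure.Haar.NormedSpace
import HarnessLib

/-!
# The Kustaanheimo–Stiefel identity and the disintegration of the quaternion rotation action
(measure-theoretic core of Tao 2016, §3.6 "by a change of variables")

T. Tao, *Finite time blowup for an averaged three-dimensional Navier–Stokes equation*,
J. Amer. Math. Soc. **29** (2016), 601–674 = arXiv:1402.0290v3, §3.6 p. 18, passes from an
integral over the slices `Σ_{ξ₁,ξ₂,ξ₃} ⊂ SO(3)³` of the incidence manifold `Σ` to an integral over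
`U ⊂ SO(3)³` with Haar measure and the Dirac mass `δ(R₁ξ₁ + R₂ξ₂ + R₃ξ₃)` "by a change of
variables … (`F'` multiplied by some Jacobian factors)".  In the quaternion parametrisation of
`TaoAveragedQuaternionRotation.lean` (rotations `ρ(q)`, Lebesgue measure on `ℍ ≅ ℝ⁴` in place of
Haar measure) the one genuinely non-linear ingredient of that change of variables is the law of
the vector `r ρ(q̄) e₀ ∈ ℝ³` when `q` is Lebesgue-distributed on `ℍ` (with a radial profile) and
`r > 0` is Lebesgue-distributed: it is Lebesgue measure on `ℝ³` with an explicit radial density.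
This file proves exactly that, through the classical **Kustaanheimo–Stiefel identity**

  `∫_{ℝ⁴} f(KS(q)) dq = (π/4) ∫_{ℝ³} f(x) |x|⁻¹ dx`,  `KS(q) = Im(q̄ i q)`, `|KS(q)| = |q|²`

(P. Kustaanheimo, E. Stiefel, J. reine angew. Math. 218 (1965) 204–219; the measure-theoretic
shadow of the Hopf fibration), proved here from scratch in coordinates `ℍ ≅ ℂ²`:
Tonelli, the linear substitution `(a,b) ↦ (2(bc-ad), 2(ac+bd))` (Jacobian `4(c²+d²)`,
Brahmagupta–Fibonacci), polar coordinates in `(c,d)` (Mathlib's `polarCoord`), and the monotone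
substitution `τ = |w|²/(4r²) - r²` (with `√(τ²+|w|²) = |w|²/(4r²) + r²`).

* `euc3Equiv`, `quatPairsEquiv` — measure-preserving coordinates `ℝ³ ≃ᵐ ℝ × ℝ × ℝ`,
  `ℍ ≃ᵐ (ℝ × ℝ) × (ℝ × ℝ)`; `lintegral_radial_prod` (radial functions on `ℝ²`);
  `lintegral_Ioi_comp_mul`, `lintegral_quat_comp_smul` (scalings);
* `ksLin`, `ksCoord`, `lintegral_comp_ksCoord` — **the KS identity in coordinates**;
* `ksVec q = Im(q̄ i q) = |q|² ρ(q̄) e₀` (`ksVec_eq_smul_qrotFun`, `norm_ksVec`) and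
  **`lintegral_comp_ksVec` — the KS identity on `ℍ`**;
* **`lintegral_rot_radial` — the disintegration `(Kr)`**:
  `∫_{r>0} ∫_ℍ g(|q|) Φ(r) k(r ρ(q̄) e₀) dq dr = (π/4) c_g ∫_{ℝ³} k(x) Φ(|x|) |x|⁻² dx`
  with `c_g = ksRadialConst g = ∫_{s>0} s⁻³ g(s^{-1/2}) ds`.

Everything is stated for `ℝ≥0∞`-valued measurable integrands (lower Lebesgue integrals), so that
no integrability hypotheses are needed.  Related material elsewhere in the tree: the
un-normalised matrix of `v ↦ q v q̄` and its determinant also appear as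
`Literature.AlgebraicTopology.FundamentalGroup.quatRot` (RotationGroupSO3.lean), in the service of
`π₁(SO(3))`; the present analytic development (isometries of `EuclideanSpace`, Lebesgue measure)
is kept separate so as not to make fluid PDE depend on covering-space theory.

## References

* T. Tao, J. Amer. Math. Soc. 29 (2016), 601–674, arXiv:1402.0290v3, §3.6 p. 18. Key
  `Tao2016AveragedNS`.
* P. Kustaanheimo, E. Stiefel, *Perturbation theory of Kepler motion based on spinor
  regularization*, J. reine angew. Math. 218 (1965), 204–219 (the map and its volume element;
  stated here as folklore, proved in full).
-/

noncomputable section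

open Real MeasureTheory Quaternion
open scoped RealInnerProductSpace Quaternion ENNReal

namespace Literature.Analysis.FluidPDE.Tao2016

/-- Local notation for physical / frequency space `ℝ³`. -/
local notation "ℝ³" => EuclideanSpace ℝ (Fin 3)

section KSOpen
open Set MeasureTheory.Measure ENNReal

attribute [local instance] quatMeasurableSpace quatBorelSpace

/-! ### Coordinates: `ℝ³ ≃ᵐ ℝ × ℝ × ℝ` and `ℍ ≃ᵐ (ℝ × ℝ) × (ℝ × ℝ)`, measure preserving -/

/-- The coordinate map `ℝ³ → ℝ × ℝ × ℝ`, `x ↦ (x₀, (x₁, x₂))`, as a measurable equivalence. [folklore] -/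
def euc3Equiv : ℝ³ ≃ᵐ ℝ × ℝ × ℝ :=
  (MeasurableEquiv.toLp 2 (Fin 3 → ℝ)).symm.trans
    ((MeasurableEquiv.piFinSuccAbove (fun _ => ℝ) 0).trans
      (MeasurableEquiv.prodCongr (MeasurableEquiv.refl ℝ) MeasurableEquiv.finTwoArrow))

/-- `euc3Equiv x = (x₀, x₁, x₂)`. [folklore] -/
@[simp] theorem euc3Equiv_apply (x : ℝ³) : euc3Equiv x = (x 0, x 1, x 2) := rfl

/-- **`euc3Equiv` preserves Lebesgue measure.** [folklore] -/
theorem measurePreserving_euc3Equiv : MeasurePreserving euc3Equiv volume volume :=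
  (EuclideanSpace.volume_preserving_symm_measurableEquiv_toLp (Fin 3)).trans
    ((volume_preserving_piFinSuccAbove (fun _ : Fin 3 => ℝ) 0).trans
      ((MeasurePreserving.id volume).prod (volume_preserving_finTwoArrow ℝ)))

/-- Transfer of lower integrals along `euc3Equiv`: `∫ F(x₀,x₁,x₂) dx = ∫ F dy`. [folklore] -/
theorem lintegral_comp_euc3Equiv (F : ℝ × ℝ × ℝ → ℝ≥0∞) :
    ∫⁻ x : ℝ³, F (x 0, x 1, x 2) = ∫⁻ y : ℝ × ℝ × ℝ, F y := by
  have h := measurePreserving_euc3Equiv.lintegral_comp_emb euc3Equiv.measurableEmbedding F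
  simpa using h

/-- The coordinate map `ℍ → (ℝ × ℝ) × (ℝ × ℝ)`, `q ↦ ((q₀, q₁), (q₂, q₃))` (i.e. `(z₁, z₂)` with
`z₁ = q₀ + q₁ i`, `z₂ = q₂ + q₃ i`), as a measurable equivalence. [folklore] -/
def quatPairsEquiv : ℍ ≃ᵐ (ℝ × ℝ) × (ℝ × ℝ) :=
  (linearIsometryEquivTuple.toHomeomorph.toMeasurableEquiv.trans
    ((MeasurableEquiv.toLp 2 (Fin 4 → ℝ)).symm.trans
      ((MeasurableEquiv.piFinSuccAbove (fun _ => ℝ) 0).trans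
        (MeasurableEquiv.prodCongr (MeasurableEquiv.refl ℝ)
          ((MeasurableEquiv.piFinSuccAbove (fun _ => ℝ) 0).trans
            (MeasurableEquiv.prodCongr (MeasurableEquiv.refl ℝ) MeasurableEquiv.finTwoArrow)))))).trans
    MeasurableEquiv.prodAssoc.symm

/-- `quatPairsEquiv q = ((q₀, q₁), (q₂, q₃))`. [folklore] -/
@[simp] theorem quatPairsEquiv_apply (q : ℍ) :
    quatPairsEquiv q = ((q.re, q.imI), (q.imJ, q.imK)) := rfl

/-- `prodAssoc` preserves product measures. [folklore] -/
theorem measurePreserving_prodAssoc_volume :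
    MeasurePreserving (MeasurableEquiv.prodAssoc : (ℝ × ℝ) × (ℝ × ℝ) ≃ᵐ ℝ × ℝ × ℝ × ℝ) volume volume :=
  ⟨MeasurableEquiv.prodAssoc.measurable, Measure.prodAssoc_prod⟩

/-- **`quatPairsEquiv` preserves Lebesgue measure** (`ℍ` with the volume of the real inner product
space `ℍ ≅ ℝ⁴`). [folklore] -/
theorem measurePreserving_quatPairsEquiv : MeasurePreserving quatPairsEquiv volume volume := by
  refine MeasurePreserving.trans ?_ measurePreserving_prodAssoc_volume.symm
  refine (linearIsometryEquivTuple.measurePreserving).trans ?_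
  refine (EuclideanSpace.volume_preserving_symm_measurableEquiv_toLp (Fin 4)).trans ?_
  refine (volume_preserving_piFinSuccAbove (fun _ : Fin 4 => ℝ) 0).trans ?_
  refine (MeasurePreserving.id volume).prod ?_
  exact (volume_preserving_piFinSuccAbove (fun _ : Fin 3 => ℝ) 0).trans
    ((MeasurePreserving.id volume).prod (volume_preserving_finTwoArrow ℝ))

/-- Transfer of lower integrals along `quatPairsEquiv`. [folklore] -/
theorem lintegral_comp_quatPairsEquiv (F : (ℝ × ℝ) × (ℝ × ℝ) → ℝ≥0∞) :
    ∫⁻ q : ℍ, F ((q.re, q.imI), (q.imJ, q.imK)) = ∫⁻ y : (ℝ × ℝ) × (ℝ × ℝ), F y := by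
  have h := measurePreserving_quatPairsEquiv.lintegral_comp_emb quatPairsEquiv.measurableEmbedding F
  simpa using h

/-! ### Radial integration on `ℝ²` and one-dimensional substitutions -/

/-- **Integration of a radial function on `ℝ²` in polar coordinates**:
`∫_{ℝ²} G(x² + y²) = 2π ∫_{r>0} r G(r²) dr`. [folklore] -/
theorem lintegral_radial_prod (G : ℝ → ℝ≥0∞) (hG : Measurable G) :
    ∫⁻ p : ℝ × ℝ, G (p.1 ^ 2 + p.2 ^ 2) =
      ENNReal.ofReal (2 * π) * ∫⁻ r in Ioi (0 : ℝ), ENNReal.ofReal r * G (r ^ 2) := by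
  rw [← lintegral_comp_polarCoord_symm, polarCoord_target]
  have hrad : ∀ p : ℝ × ℝ, (polarCoord.symm p).1 ^ 2 + (polarCoord.symm p).2 ^ 2 = p.1 ^ 2 := by
    intro p
    simp only [polarCoord_symm_apply]
    nlinarith [Real.cos_sq_add_sin_sq p.2]
  simp_rw [hrad]
  have hmeas : Measurable fun r : ℝ => ENNReal.ofReal r * G (r ^ 2) :=
    (ENNReal.measurable_ofReal.comp measurable_id).mul (hG.comp (measurable_id.pow_const 2))
  rw [Measure.volume_eq_prod, setLIntegral_prod _ (Measurable.aemeasurable (by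
    exact ((ENNReal.measurable_ofReal.comp measurable_fst).smul (hG.comp (measurable_fst.pow_const 2)))))]
  have h2 : ENNReal.ofReal (π - -π) = ENNReal.ofReal (2 * π) := by congr 1; ring
  simp only [smul_eq_mul, setLIntegral_const, Real.volume_Ioo, h2]
  rw [lintegral_mul_const _ hmeas, mul_comm]

end KSOpen
section KSCore
open Set MeasureTheory.Measure ENNReal

attribute [local instance] quatMeasurableSpace quatBorelSpace

/-! ### Scalings -/

/-- **Linear substitution on `(0, ∞)`**: `∫_{x>0} g(x) dx = c ∫_{x>0} g(c x) dx` (`c > 0`). [folklore] -/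
theorem lintegral_Ioi_comp_mul {c : ℝ} (hc : 0 < c) (g : ℝ → ℝ≥0∞) :
    ∫⁻ x in Ioi (0 : ℝ), g x = ENNReal.ofReal c * ∫⁻ x in Ioi (0 : ℝ), g (c * x) := by
  have himg : (fun x : ℝ => c * x) '' Ioi 0 = Ioi 0 := by
    rw [image_mul_left_Ioi hc, mul_zero]
  have hd : ∀ x ∈ Ioi (0 : ℝ), HasDerivWithinAt (fun x : ℝ => c * x) c (Ioi 0) x := fun x _ => by
    simpa using ((hasDerivAt_id x).const_mul c).hasDerivWithinAt
  rw [← himg, lintegral_image_eq_lintegral_abs_deriv_mul measurableSet_Ioi hd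
    (fun x _ y _ hxy => mul_left_cancel₀ hc.ne' hxy), himg]
  simp only [abs_of_pos hc]
  rw [lintegral_const_mul' _ _ ENNReal.ofReal_ne_top]

/-- **Homothety substitution on `ℍ ≅ ℝ⁴`**: `∫ ψ(q) dq = |r|⁴ ∫ ψ(r q) dq` (`r ≠ 0`). [folklore] -/
theorem lintegral_quat_comp_smul {r : ℝ} (hr : r ≠ 0) (ψ : ℍ → ℝ≥0∞) :
    ∫⁻ q : ℍ, ψ q = ENNReal.ofReal (|r| ^ 4) * ∫⁻ q : ℍ, ψ (r • q) := by
  have hmap := Measure.map_addHaar_smul (volume : Measure ℍ) hr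
  rw [Quaternion.finrank_eq_four] at hmap
  have h1 : ∫⁻ q : ℍ, ψ (r • q) = ∫⁻ q, ψ q ∂(Measure.map (fun q : ℍ => r • q) volume) :=
    (lintegral_map_equiv ψ (Homeomorph.smulOfNeZero r hr).toMeasurableEquiv).symm
  rw [h1, hmap, lintegral_smul_measure, smul_eq_mul, ← mul_assoc, ← ENNReal.ofReal_mul (by positivity),
    abs_inv, abs_pow, mul_inv_cancel₀ (pow_ne_zero 4 (abs_ne_zero.mpr hr)), ENNReal.ofReal_one, one_mul]

/-! ### The linear map `(a,b) ↦ (2(bc - ad), 2(ac + bd))` and its determinant -/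

/-- For fixed `(c, d)`, the linear map `(a, b) ↦ (2(bc - ad), 2(ac + bd))` of `ℝ²` (the last two
coordinates of the quadratic Hopf map). [folklore] -/
def ksLin (cd : ℝ × ℝ) : ℝ × ℝ →ₗ[ℝ] ℝ × ℝ :=
  Matrix.toLin (Module.Basis.finTwoProd ℝ) (Module.Basis.finTwoProd ℝ)
    !![-2 * cd.2, 2 * cd.1; 2 * cd.1, 2 * cd.2]

/-- `ksLin (c,d) (a,b) = (2(bc - ad), 2(ac + bd))`. [folklore] -/
theorem ksLin_apply (cd ab : ℝ × ℝ) :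
    ksLin cd ab = (2 * (ab.2 * cd.1 - ab.1 * cd.2), 2 * (ab.1 * cd.1 + ab.2 * cd.2)) := by
  rw [ksLin, Matrix.toLin_finTwoProd_apply]
  ext <;> simp <;> ring

/-- `det ksLin (c,d) = -4 (c² + d²)`. [folklore] -/
theorem det_ksLin (cd : ℝ × ℝ) : LinearMap.det (ksLin cd) = -4 * (cd.1 ^ 2 + cd.2 ^ 2) := by
  rw [ksLin, LinearMap.det_toLin, Matrix.det_fin_two_of]
  ring

/-- **Brahmagupta–Fibonacci**: `|ksLin (c,d) (a,b)|² = 4 (c² + d²)(a² + b²)`. [folklore] -/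
theorem normSq_ksLin (cd ab : ℝ × ℝ) :
    (ksLin cd ab).1 ^ 2 + (ksLin cd ab).2 ^ 2 = 4 * (cd.1 ^ 2 + cd.2 ^ 2) * (ab.1 ^ 2 + ab.2 ^ 2) := by
  rw [ksLin_apply]
  ring

/-- `ksLin` is continuous. [folklore] -/
theorem continuous_ksLin (cd : ℝ × ℝ) : Continuous (ksLin cd) :=
  LinearMap.continuous_of_finiteDimensional _

/-- **Linear change of variables for `ksLin`**: `∫ F(ksLin ab) dab = (4(c²+d²))⁻¹ ∫ F(w) dw`
(`(c,d) ≠ 0`). [folklore] -/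
theorem lintegral_comp_ksLin {cd : ℝ × ℝ} (hcd : cd.1 ^ 2 + cd.2 ^ 2 ≠ 0) {F : ℝ × ℝ → ℝ≥0∞}
    (hF : Measurable F) :
    ∫⁻ ab : ℝ × ℝ, F (ksLin cd ab) =
      (ENNReal.ofReal (4 * (cd.1 ^ 2 + cd.2 ^ 2)))⁻¹ * ∫⁻ w : ℝ × ℝ, F w := by
  have hpos : 0 < cd.1 ^ 2 + cd.2 ^ 2 := lt_of_le_of_ne (by positivity) (Ne.symm hcd)
  have hdet : LinearMap.det (ksLin cd) ≠ 0 := by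
    rw [det_ksLin]; intro h; apply hcd; linarith
  rw [← lintegral_map hF (continuous_ksLin cd).measurable,
    Measure.map_linearMap_addHaar_eq_smul_addHaar _ hdet, lintegral_smul_measure, det_ksLin, smul_eq_mul]
  congr 1
  rw [abs_inv, show -4 * (cd.1 ^ 2 + cd.2 ^ 2) = -(4 * (cd.1 ^ 2 + cd.2 ^ 2)) by ring, abs_neg,
    abs_of_nonneg (by positivity), ENNReal.ofReal_inv_of_pos (by positivity)]

/-! ### The one-dimensional substitution `r ↦ A/(4r²) - r²` -/

/-- The third coordinate of the KS map in adapted variables: `m_A(r) = A/(4r²) - r²`. [folklore] -/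
def ksRad (A r : ℝ) : ℝ := A / (4 * r ^ 2) - r ^ 2

/-- `√(m_A(r)² + A) = A/(4r²) + r²` (`A ≥ 0`, `r ≠ 0`). [folklore] -/
theorem sqrt_ksRad_sq_add {A r : ℝ} (hA : 0 ≤ A) (hr : r ≠ 0) :
    Real.sqrt (ksRad A r ^ 2 + A) = A / (4 * r ^ 2) + r ^ 2 := by
  have h : ksRad A r ^ 2 + A = (A / (4 * r ^ 2) + r ^ 2) ^ 2 := by
    rw [ksRad]; field_simp; ring
  rw [h, Real.sqrt_sq (by positivity)]

/-- `m_A` is strictly decreasing on `(0, ∞)` (`A ≥ 0`). [folklore] -/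
theorem strictAntiOn_ksRad {A : ℝ} (hA : 0 ≤ A) : StrictAntiOn (ksRad A) (Ioi 0) := by
  intro r hr s hs hrs
  simp only [ksRad, mem_Ioi] at *
  have h1 : A / (4 * s ^ 2) ≤ A / (4 * r ^ 2) := by
    apply div_le_div_of_nonneg_left hA (by positivity)
    nlinarith
  nlinarith

/-- The derivative of `m_A`: `m_A'(r) = -A/(2r³) - 2r`. [folklore] -/
theorem hasDerivAt_ksRad (A : ℝ) {r : ℝ} (hr : r ≠ 0) :
    HasDerivAt (ksRad A) (-(A / (2 * r ^ 3)) - 2 * r) r := by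
  have e : ksRad A = fun y : ℝ => A * (4 * y ^ 2)⁻¹ - y ^ 2 := by
    funext y; rw [ksRad, div_eq_mul_inv]
  have h4 : HasDerivAt (fun y : ℝ => 4 * y ^ 2) (4 * (2 * r)) r := by
    simpa using (hasDerivAt_pow 2 r).const_mul 4
  have hinv : HasDerivAt (fun y : ℝ => (4 * y ^ 2)⁻¹) (-(4 * (2 * r)) / (4 * r ^ 2) ^ 2) r :=
    h4.inv (by positivity)
  have h1 : HasDerivAt (fun y : ℝ => A * (4 * y ^ 2)⁻¹) (-(A / (2 * r ^ 3))) r :=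
    (hinv.const_mul A).congr_deriv (by field_simp; ring)
  have h2 : HasDerivAt (fun y : ℝ => y ^ 2) (2 * r) r := by
    simpa using hasDerivAt_pow 2 r
  rw [e]
  exact h1.sub h2

/-- `m_A` maps `(0, ∞)` onto `ℝ` (`A > 0`): the explicit preimage of `τ` is
`r = ((√(τ²+A) - τ)/2)^{1/2}`. [folklore] -/
theorem image_ksRad_Ioi {A : ℝ} (hA : 0 < A) : ksRad A '' Ioi 0 = univ := by
  refine eq_univ_of_forall fun τ => ?_
  set S := Real.sqrt (τ ^ 2 + A) with hS
  have hSτ : τ < S := by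
    rw [hS]
    rcases lt_or_ge τ 0 with hτ | hτ
    · exact lt_of_lt_of_le hτ (Real.sqrt_nonneg _)
    · calc τ = Real.sqrt (τ ^ 2) := (Real.sqrt_sq hτ).symm
        _ < Real.sqrt (τ ^ 2 + A) := Real.sqrt_lt_sqrt (sq_nonneg _) (by linarith)
  have hS2 : S ^ 2 = τ ^ 2 + A := by rw [hS, Real.sq_sqrt (by positivity)]
  set r := Real.sqrt ((S - τ) / 2) with hr
  have hr2 : r ^ 2 = (S - τ) / 2 := by rw [hr, Real.sq_sqrt (by linarith)]
  have hrpos : 0 < r := by rw [hr]; exact Real.sqrt_pos.mpr (by linarith)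
  refine ⟨r, hrpos, ?_⟩
  rw [ksRad, hr2]
  have hne : S - τ ≠ 0 := by linarith
  field_simp
  nlinarith [hS2]

/-- **The substitution `τ = A/(4r²) - r²`**:
`∫_{r>0} r⁻¹ F(A/(4r²) - r²) dr = ∫_ℝ F(τ) / (2√(τ² + A)) dτ` (`A > 0`). [folklore] -/
theorem lintegral_Ioi_ksRad {A : ℝ} (hA : 0 < A) (F : ℝ → ℝ≥0∞) :
    ∫⁻ r in Ioi (0 : ℝ), ENNReal.ofReal r⁻¹ * F (ksRad A r) =
      ∫⁻ τ : ℝ, F τ * ENNReal.ofReal (2 * Real.sqrt (τ ^ 2 + A))⁻¹ := by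
  have h := lintegral_image_eq_lintegral_abs_deriv_mul measurableSet_Ioi
    (fun r hr => (hasDerivAt_ksRad A (ne_of_gt hr)).hasDerivWithinAt) (strictAntiOn_ksRad hA.le).injOn
    (fun τ => F τ * ENNReal.ofReal (2 * Real.sqrt (τ ^ 2 + A))⁻¹)
  rw [image_ksRad_Ioi hA, Measure.restrict_univ] at h
  rw [h]
  refine setLIntegral_congr_fun measurableSet_Ioi fun r hr => ?_
  rw [mem_Ioi] at hr
  rw [sqrt_ksRad_sq_add hA.le hr.ne', mul_comm (F _), ← mul_assoc]
  congr 1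
  rw [← ENNReal.ofReal_mul (abs_nonneg _)]
  congr 1
  rw [show -(A / (2 * r ^ 3)) - 2 * r = -(A / (2 * r ^ 3) + 2 * r) by ring, abs_neg,
    abs_of_pos (by positivity)]
  field_simp
  ring

end KSCore
section KSMain
open Set MeasureTheory.Measure ENNReal

attribute [local instance] quatMeasurableSpace quatBorelSpace

/-! ### The Kustaanheimo–Stiefel identity in coordinates -/

/-- **The quadratic Hopf (Kustaanheimo–Stiefel) map in coordinates**:
`((a,b),(c,d)) ↦ (a² + b² - c² - d², 2(bc - ad), 2(ac + bd))`. [folklore] -/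
def ksCoord (p : (ℝ × ℝ) × (ℝ × ℝ)) : ℝ × ℝ × ℝ :=
  (p.1.1 ^ 2 + p.1.2 ^ 2 - (p.2.1 ^ 2 + p.2.2 ^ 2), ksLin p.2 p.1)

/-- `ksCoord` is continuous. [folklore] -/
theorem continuous_ksCoord : Continuous ksCoord := by
  unfold ksCoord
  refine Continuous.prodMk (by fun_prop) ?_
  have h : (fun p : (ℝ × ℝ) × (ℝ × ℝ) => ksLin p.2 p.1) = fun p =>
      (2 * (p.1.2 * p.2.1 - p.1.1 * p.2.2), 2 * (p.1.1 * p.2.1 + p.1.2 * p.2.2)) := by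
    funext p; exact ksLin_apply p.2 p.1
  rw [h]
  fun_prop

/-- `|KS(p)| = |p|²`: `‖ksCoord p‖₂ = a² + b² + c² + d²`. [folklore] -/
theorem ksCoord_normSq (p : (ℝ × ℝ) × (ℝ × ℝ)) :
    (ksCoord p).1 ^ 2 + ((ksCoord p).2.1 ^ 2 + (ksCoord p).2.2 ^ 2) =
      (p.1.1 ^ 2 + p.1.2 ^ 2 + (p.2.1 ^ 2 + p.2.2 ^ 2)) ^ 2 := by
  simp only [ksCoord, ksLin_apply]
  ring

/-- A singleton is Lebesgue-null in `ℝ²`; hence a.e. `(c,d)` has `c² + d² ≠ 0`. [folklore] -/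
theorem ae_sq_add_sq_ne_zero : ∀ᵐ cd : ℝ × ℝ, cd.1 ^ 2 + cd.2 ^ 2 ≠ 0 := by
  have h0 : (volume : Measure (ℝ × ℝ)) {(0 : ℝ × ℝ)} = 0 := by
    rw [Measure.volume_eq_prod]; exact measure_singleton _
  have h1 : ∀ᵐ cd : ℝ × ℝ, cd ∉ ({(0 : ℝ × ℝ)} : Set (ℝ × ℝ)) := compl_mem_ae_iff.mpr h0
  refine h1.mono fun cd hcd h => hcd ?_
  rw [mem_singleton_iff]
  have ha : cd.1 = 0 := by nlinarith [sq_nonneg cd.1, sq_nonneg cd.2]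
  have hb : cd.2 = 0 := by nlinarith [sq_nonneg cd.1, sq_nonneg cd.2]
  exact Prod.ext ha hb

/-- **The Kustaanheimo–Stiefel identity (coordinate form)**: for measurable `f ≥ 0` on `ℝ³`,
`∫_{ℝ⁴} f(KS(p)) dp = (π/4) ∫_{ℝ³} f(y) |y|⁻¹ dy`.  Proof: Tonelli; for fixed `(c,d) ≠ 0` the
linear substitution `(a,b) ↦ w = ksLin (c,d) (a,b)` (Jacobian `4(c²+d²)`, and
`a² + b² = |w|²/(4(c²+d²))`); Tonelli; polar coordinates in `(c,d)`; the substitution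
`τ = |w|²/(4r²) - r²` with `√(τ² + |w|²) = |w|²/(4r²) + r²`. [folklore] -/
theorem lintegral_comp_ksCoord (f : ℝ × ℝ × ℝ → ℝ≥0∞) (hf : Measurable f) :
    ∫⁻ p, f (ksCoord p) = ENNReal.ofReal (π / 4) *
      ∫⁻ y : ℝ × ℝ × ℝ, f y * (ENNReal.ofReal (Real.sqrt (y.1 ^ 2 + (y.2.1 ^ 2 + y.2.2 ^ 2))))⁻¹ := by
  -- notation
  set ρ2 : ℝ × ℝ → ℝ := fun cd => cd.1 ^ 2 + cd.2 ^ 2 with hρ2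
  have hρ2m : Measurable ρ2 := by rw [hρ2]; fun_prop
  have hρ2c : Continuous ρ2 := by rw [hρ2]; fun_prop
  -- the integrand after the linear substitution
  set g : ℝ × ℝ → ℝ × ℝ → ℝ≥0∞ := fun cd w => f (ρ2 w / (4 * ρ2 cd) - ρ2 cd, w) with hg
  have hgm : Measurable (Function.uncurry g) := by
    rw [hg]
    refine hf.comp (Measurable.prodMk ?_ measurable_snd)
    exact ((hρ2m.comp measurable_snd).div ((hρ2m.comp measurable_fst).const_mul 4)).sub
      (hρ2m.comp measurable_fst)
  -- Step 1: Tonelli, `(c,d)` outside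
  rw [Measure.volume_eq_prod, lintegral_prod_symm (fun p : (ℝ × ℝ) × (ℝ × ℝ) => f (ksCoord p))
    (hf.comp continuous_ksCoord.measurable).aemeasurable]
  -- Step 2: the linear substitution in `(a,b)` for `(c,d) ≠ 0`
  have step2 : ∀ cd : ℝ × ℝ, ρ2 cd ≠ 0 →
      ∫⁻ ab : ℝ × ℝ, f (ksCoord (ab, cd)) = (ENNReal.ofReal (4 * ρ2 cd))⁻¹ * ∫⁻ w : ℝ × ℝ, g cd w := by
    intro cd hcd
    have h4 : (4 : ℝ) * (cd.1 ^ 2 + cd.2 ^ 2) ≠ 0 := mul_ne_zero four_ne_zero hcd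
    have hfun : (fun ab : ℝ × ℝ => f (ksCoord (ab, cd))) = fun ab => g cd (ksLin cd ab) := by
      funext ab
      simp only [hg, ksCoord, hρ2]
      rw [normSq_ksLin, mul_div_cancel_left₀ _ h4]
    have hgcd : Measurable (g cd) := hgm.comp (measurable_const.prodMk measurable_id)
    rw [hfun, lintegral_comp_ksLin hcd hgcd]
  rw [lintegral_congr_ae (ae_sq_add_sq_ne_zero.mono fun cd hcd => step2 cd hcd)]
  -- Step 3: constant inside, swap
  have step3 : ∀ cd : ℝ × ℝ, (ENNReal.ofReal (4 * ρ2 cd))⁻¹ * ∫⁻ w : ℝ × ℝ, g cd w =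
      ∫⁻ w : ℝ × ℝ, (ENNReal.ofReal (4 * ρ2 cd))⁻¹ * g cd w := fun cd =>
    (lintegral_const_mul _ (hgm.comp (measurable_const.prodMk measurable_id))).symm
  simp_rw [step3]
  have hKm : Measurable (Function.uncurry fun (cd w : ℝ × ℝ) => (ENNReal.ofReal (4 * ρ2 cd))⁻¹ * g cd w) :=
    ((ENNReal.measurable_ofReal.comp ((hρ2m.comp measurable_fst).const_mul 4)).inv).mul hgm
  rw [lintegral_lintegral_swap hKm.aemeasurable]
  -- Step 4 & 5: for a.e. `w`, the radial `(c,d)`-integral and the `τ`-substitution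
  have step45 : ∀ w : ℝ × ℝ, ρ2 w ≠ 0 →
      ∫⁻ cd : ℝ × ℝ, (ENNReal.ofReal (4 * ρ2 cd))⁻¹ * g cd w =
        ENNReal.ofReal (π / 4) * ∫⁻ τ : ℝ, f (τ, w) * (ENNReal.ofReal (Real.sqrt (τ ^ 2 + ρ2 w)))⁻¹ := by
    intro w hw
    have hwpos : 0 < ρ2 w := lt_of_le_of_ne (by rw [hρ2]; positivity) (Ne.symm hw)
    -- radial integrand
    set G : ℝ → ℝ≥0∞ := fun P => (ENNReal.ofReal (4 * P))⁻¹ * f (ρ2 w / (4 * P) - P, w) with hG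
    have hGm : Measurable G := by
      rw [hG]
      refine ((ENNReal.measurable_ofReal.comp (measurable_id.const_mul 4)).inv).mul ?_
      exact hf.comp (Measurable.prodMk ((measurable_const.div (measurable_id.const_mul 4)).sub
        measurable_id) measurable_const)
    have hrad : (fun cd : ℝ × ℝ => (ENNReal.ofReal (4 * ρ2 cd))⁻¹ * g cd w) = fun cd => G (cd.1 ^ 2 + cd.2 ^ 2) := by
      funext cd; rfl
    rw [hrad, lintegral_radial_prod G hGm]
    -- simplify `r G(r²)` on `(0,∞)`
    have hsimp : ∀ r ∈ Ioi (0 : ℝ), ENNReal.ofReal r * G (r ^ 2) =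
        ENNReal.ofReal (1 / 4) * (ENNReal.ofReal r⁻¹ * f (ksRad (ρ2 w) r, w)) := by
      intro r hr
      rw [mem_Ioi] at hr
      rw [hG]
      simp only [ksRad]
      rw [← mul_assoc, ← mul_assoc]
      congr 1
      rw [← ENNReal.ofReal_inv_of_pos (by positivity), ← ENNReal.ofReal_mul hr.le,
        ← ENNReal.ofReal_mul (by norm_num)]
      congr 1
      field_simp
    rw [setLIntegral_congr_fun measurableSet_Ioi hsimp, lintegral_const_mul' _ _ ENNReal.ofReal_ne_top,
      lintegral_Ioi_ksRad hwpos (fun τ => f (τ, w))]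
    -- constants
    have hhalf : ∀ τ : ℝ, f (τ, w) * ENNReal.ofReal (2 * Real.sqrt (τ ^ 2 + ρ2 w))⁻¹ =
        ENNReal.ofReal (1 / 2) * (f (τ, w) * (ENNReal.ofReal (Real.sqrt (τ ^ 2 + ρ2 w)))⁻¹) := by
      intro τ
      have hS : 0 < Real.sqrt (τ ^ 2 + ρ2 w) := Real.sqrt_pos.mpr (by positivity)
      rw [mul_left_comm]
      congr 1
      rw [← ENNReal.ofReal_inv_of_pos hS, ← ENNReal.ofReal_mul (by norm_num)]
      congr 1
      field_simp
    simp_rw [hhalf]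
    rw [lintegral_const_mul' _ _ ENNReal.ofReal_ne_top, ← mul_assoc, ← mul_assoc,
      ← ENNReal.ofReal_mul (by positivity), ← ENNReal.ofReal_mul (by positivity)]
    congr 2
    ring
  rw [lintegral_congr_ae (ae_sq_add_sq_ne_zero.mono fun w hw => step45 w hw)]
  -- Step 6: reassemble
  have hΦm : Measurable (Function.uncurry fun (τ : ℝ) (w : ℝ × ℝ) =>
      f (τ, w) * (ENNReal.ofReal (Real.sqrt (τ ^ 2 + ρ2 w)))⁻¹) := by
    refine (hf.comp measurable_id).mul ?_
    exact (ENNReal.measurable_ofReal.comp ((measurable_fst.pow_const 2).add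
      (hρ2m.comp measurable_snd)).sqrt).inv
  have hm6 : Measurable fun w : ℝ × ℝ => ∫⁻ τ : ℝ, f (τ, w) * (ENNReal.ofReal (Real.sqrt (τ ^ 2 + ρ2 w)))⁻¹ :=
    hΦm.lintegral_prod_left'
  rw [lintegral_const_mul _ hm6]
  congr 1
  have hRm : Measurable fun y : ℝ × ℝ × ℝ =>
      f y * (ENNReal.ofReal (Real.sqrt (y.1 ^ 2 + (y.2.1 ^ 2 + y.2.2 ^ 2))))⁻¹ := by
    refine hf.mul (ENNReal.measurable_ofReal.comp ?_).inv
    fun_prop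
  conv_rhs => rw [Measure.volume_eq_prod]
  rw [lintegral_prod_symm _ hRm.aemeasurable]

end KSMain
section KSQuat
open Set MeasureTheory.Measure ENNReal

attribute [local instance] quatMeasurableSpace quatBorelSpace

/-! ### The KS map on `ℍ` and the rotation action -/

/-- The reference unit vector `e₀ = (1, 0, 0)`. [folklore] -/
def ksE0 : ℝ³ := !₂[1, 0, 0]

/-- `|e₀| = 1`. [folklore] -/
@[simp] theorem norm_ksE0 : ‖ksE0‖ = 1 := by
  simp [ksE0, EuclideanSpace.norm_eq, Fin.sum_univ_three]

/-- `quatOf e₀ = i`. [folklore] -/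
theorem quatOf_ksE0 : quatOf ksE0 = ⟨0, 1, 0, 0⟩ := by
  ext <;> simp [quatOf, ksE0]

/-- **The Kustaanheimo–Stiefel map `KS(q) = Im(q̄ i q) ∈ ℝ³`** (`= |q|² ρ(q̄) e₀`). [folklore] -/
def ksVec (q : ℍ) : ℝ³ := vecOf (star q * quatOf ksE0 * q)

/-- Coordinates of `KS`: `euc3Equiv (KS q) = ksCoord ((q₀,q₁),(q₂,q₃))`. [folklore] -/
theorem euc3Equiv_ksVec (q : ℍ) : euc3Equiv (ksVec q) = ksCoord ((q.re, q.imI), (q.imJ, q.imK)) := by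
  rw [euc3Equiv_apply, ksCoord, ksLin_apply]
  simp only [ksVec, quatOf_ksE0, vecOf_apply_zero, vecOf_apply_one, vecOf_apply_two, Quaternion.imI_mul,
    Quaternion.imJ_mul, Quaternion.imK_mul, Quaternion.re_mul, Quaternion.re_star, Quaternion.imI_star,
    Quaternion.imJ_star, Quaternion.imK_star]
  ext <;> ring

/-- **`KS(q) = |q|² ρ(q̄) e₀`.** [folklore] -/
theorem ksVec_eq_smul_qrotFun (q : ℍ) : ksVec q = normSq q • qrotFun (star q) ksE0 := by
  by_cases hq : q = 0
  · subst hq; simp [ksVec, qrotFun]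
  have hN : normSq q ≠ 0 := fun h => hq (normSq_eq_zero.1 h)
  rw [qrotFun, normSq_star, smul_smul, mul_inv_cancel₀ hN, one_smul, star_star, ksVec]

/-- `|KS(q)| = |q|²`. [folklore] -/
theorem norm_ksVec (q : ℍ) : ‖ksVec q‖ = ‖q‖ ^ 2 := by
  by_cases hq : q = 0
  · subst hq; simp [ksVec]
  rw [ksVec_eq_smul_qrotFun, norm_smul, norm_qrotFun (star_ne_zero.mpr hq), norm_ksE0, mul_one,
    Real.norm_of_nonneg normSq_nonneg, normSq_eq_norm_mul_self, sq]

/-- `KS` is homogeneous of degree two: `KS(c q) = c² KS(q)`. [folklore] -/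
theorem ksVec_smul (c : ℝ) (q : ℍ) : ksVec (c • q) = c ^ 2 • ksVec q := by
  rw [ksVec, ksVec, Quaternion.star_smul, smul_mul_assoc, smul_mul_assoc, mul_smul_comm, smul_smul, vecOf_smul, sq]

/-- `KS` is continuous. [folklore] -/
theorem continuous_ksVec : Continuous ksVec :=
  (contDiff_vecOf (n := 0)).continuous.comp
    (((contDiff_quat_star (n := 0)).continuous.mul continuous_const).mul continuous_id)

/-- `q ↦ ρ(q̄) v` is measurable. [folklore] -/
theorem measurable_qrotFun_star_apply (v : ℝ³) : Measurable fun q : ℍ => qrotFun (star q) v :=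
  (measurable_qrotFun_apply v).comp (contDiff_quat_star (n := 0)).continuous.measurable

/-- **The Kustaanheimo–Stiefel identity on `ℍ`**: for measurable `F ≥ 0` on `ℝ³`,
`∫_ℍ F(KS(q)) dq = (π/4) ∫_{ℝ³} F(x) |x|⁻¹ dx` (Lebesgue measure on `ℍ ≅ ℝ⁴`; Kustaanheimo–Stiefel
1965, the measure-theoretic content of the Hopf fibration). [folklore] -/
theorem lintegral_comp_ksVec (F : ℝ³ → ℝ≥0∞) (hF : Measurable F) :
    ∫⁻ q : ℍ, F (ksVec q) = ENNReal.ofReal (π / 4) * ∫⁻ x : ℝ³, F x * (ENNReal.ofReal ‖x‖)⁻¹ := by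
  set F' : ℝ × ℝ × ℝ → ℝ≥0∞ := fun y => F (euc3Equiv.symm y) with hF'
  have hF'm : Measurable F' := hF.comp euc3Equiv.symm.measurable
  have h1 : ∀ q : ℍ, F (ksVec q) = F' (ksCoord ((q.re, q.imI), (q.imJ, q.imK))) := by
    intro q; rw [← euc3Equiv_ksVec]; simp only [hF', MeasurableEquiv.symm_apply_apply]
  simp_rw [h1]
  rw [lintegral_comp_quatPairsEquiv (fun p => F' (ksCoord p)), lintegral_comp_ksCoord F' hF'm]
  congr 1
  rw [← lintegral_comp_euc3Equiv]
  refine lintegral_congr fun x => ?_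
  have hx : euc3Equiv.symm (x 0, x 1, x 2) = x := by
    rw [← euc3Equiv_apply, MeasurableEquiv.symm_apply_apply]
  simp only [hF', hx]
  congr 3
  rw [EuclideanSpace.norm_eq]
  simp [Fin.sum_univ_three, add_assoc]

/-! ### Radial profiles and the rotation-action disintegration `(Kr)` -/

/-- The constant `c_g = ∫_{s>0} s⁻³ g(s^{-1/2}) ds` of the radial profile `g`. [folklore] -/
def ksRadialConst (g : ℝ → ℝ≥0∞) : ℝ≥0∞ :=
  ∫⁻ s in Ioi (0 : ℝ), ENNReal.ofReal (s ^ 3)⁻¹ * g (Real.sqrt s)⁻¹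

/-- **Disintegration of the rotation action (`(Kr)`)**: for a radial profile `g` on `ℍ`, a
radial weight `Φ` and a test function `k` on `ℝ³` (all measurable, `≥ 0`),
`∫_{r>0} ∫_ℍ g(|q|) Φ(r) k(r ρ(q̄) e₀) dq dr = (π/4) c_g ∫_{ℝ³} k(x) Φ(|x|) |x|⁻² dx`:
averaging a fixed vector over quaternion rotations with a Lebesgue-distributed radius produces
Lebesgue measure on `ℝ³` (with density `|x|⁻²` against the radial weight).  This is the
measure-theoretic core of the passage from Haar measure on `SO(3)` to the frequency variables in
Tao's (3.16) ("by a change of variables … `F'` multiplied by some Jacobian factors", §3.6). [cite: Tao2016AveragedNS, §3.6 p. 18] -/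
theorem lintegral_rot_radial (g : ℝ → ℝ≥0∞) (hg : Measurable g) (Φ : ℝ → ℝ≥0∞) (hΦ : Measurable Φ)
    (k : ℝ³ → ℝ≥0∞) (hk : Measurable k) :
    ∫⁻ r in Ioi (0 : ℝ), ∫⁻ q : ℍ, g ‖q‖ * Φ r * k (r • qrotFun (star q) ksE0) =
      ENNReal.ofReal (π / 4) * ksRadialConst g *
        ∫⁻ x : ℝ³, k x * Φ ‖x‖ * ENNReal.ofReal (‖x‖ ^ 2)⁻¹ := by
  have hrot : Measurable fun q : ℍ => qrotFun (star q) ksE0 := measurable_qrotFun_star_apply ksE0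
  -- (i) Tonelli
  have hI : Measurable (Function.uncurry fun (r : ℝ) (q : ℍ) => g ‖q‖ * Φ r * k (r • qrotFun (star q) ksE0)) :=
    ((hg.comp (measurable_snd.norm)).mul (hΦ.comp measurable_fst)).mul
      (hk.comp (measurable_fst.smul (hrot.comp measurable_snd)))
  rw [lintegral_lintegral_swap hI.aemeasurable]
  -- (ii) `r = |q|² s` for `q ≠ 0`
  have hae : ∀ᵐ q : ℍ, q ≠ 0 := by
    have h0 : (volume : Measure ℍ) {(0 : ℍ)} = 0 := measure_singleton 0
    have h1 : ∀ᵐ q : ℍ, q ∉ ({(0 : ℍ)} : Set ℍ) := compl_mem_ae_iff.mpr h0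
    exact h1.mono fun q hq => hq
  have step2 : ∀ q : ℍ, q ≠ 0 →
      ∫⁻ r in Ioi (0 : ℝ), g ‖q‖ * Φ r * k (r • qrotFun (star q) ksE0) =
        ∫⁻ s in Ioi (0 : ℝ), g ‖q‖ * ENNReal.ofReal (‖q‖ ^ 2) * Φ (‖q‖ ^ 2 * s) * k (s • ksVec q) := by
    intro q hq
    have hq2 : 0 < ‖q‖ ^ 2 := by positivity
    rw [lintegral_Ioi_comp_mul hq2, ← lintegral_const_mul' _ _ ENNReal.ofReal_ne_top]
    refine setLIntegral_congr_fun measurableSet_Ioi fun s _ => ?_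
    rw [ksVec_eq_smul_qrotFun, smul_smul, normSq_eq_norm_mul_self, ← sq]
    ring
  rw [lintegral_congr_ae (hae.mono fun q hq => step2 q hq)]
  -- (iii) Tonelli
  have hJ : Measurable (Function.uncurry fun (q : ℍ) (s : ℝ) =>
      g ‖q‖ * ENNReal.ofReal (‖q‖ ^ 2) * Φ (‖q‖ ^ 2 * s) * k (s • ksVec q)) :=
    (((hg.comp measurable_fst.norm).mul (ENNReal.measurable_ofReal.comp (measurable_fst.norm.pow_const 2))).mul
      (hΦ.comp ((measurable_fst.norm.pow_const 2).mul measurable_snd))).mul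
      (hk.comp (measurable_snd.smul (continuous_ksVec.measurable.comp measurable_fst)))
  rw [lintegral_lintegral_swap hJ.aemeasurable]
  -- (iv) `q = s^{-1/2} q'` for `s > 0`
  have step4 : ∀ s ∈ Ioi (0 : ℝ),
      ∫⁻ q : ℍ, g ‖q‖ * ENNReal.ofReal (‖q‖ ^ 2) * Φ (‖q‖ ^ 2 * s) * k (s • ksVec q) =
        ∫⁻ q : ℍ, ENNReal.ofReal (s ^ 2)⁻¹ * (g (‖q‖ * (Real.sqrt s)⁻¹) * ENNReal.ofReal (‖q‖ ^ 2 / s) *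
          Φ (‖q‖ ^ 2) * k (ksVec q)) := by
    intro s hs
    rw [mem_Ioi] at hs
    have hc : (Real.sqrt s)⁻¹ ≠ 0 := inv_ne_zero (Real.sqrt_pos.mpr hs).ne'
    have hss : Real.sqrt s ^ 2 = s := Real.sq_sqrt hs.le
    rw [lintegral_quat_comp_smul hc, ← lintegral_const_mul' _ _ ENNReal.ofReal_ne_top]
    refine lintegral_congr fun q => ?_
    have hnorm : ‖(Real.sqrt s)⁻¹ • q‖ = ‖q‖ * (Real.sqrt s)⁻¹ := by
      rw [norm_smul, norm_inv, Real.norm_of_nonneg (Real.sqrt_nonneg _), mul_comm]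
    have habs : |(Real.sqrt s)⁻¹| ^ 4 = (s ^ 2)⁻¹ := by
      rw [abs_of_nonneg (inv_nonneg.mpr (Real.sqrt_nonneg _)), inv_pow,
        show Real.sqrt s ^ 4 = (Real.sqrt s ^ 2) ^ 2 by ring, hss]
    have hn2 : (‖q‖ * (Real.sqrt s)⁻¹) ^ 2 = ‖q‖ ^ 2 / s := by
      rw [mul_pow, inv_pow, hss, div_eq_mul_inv]
    have hks : s • ksVec ((Real.sqrt s)⁻¹ • q) = ksVec q := by
      rw [ksVec_smul, smul_smul, inv_pow, hss, mul_inv_cancel₀ hs.ne', one_smul]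
    rw [habs, hnorm, hn2, hks, div_mul_cancel₀ _ hs.ne']
  rw [setLIntegral_congr_fun measurableSet_Ioi step4]
  -- (v) Tonelli
  have hK : Measurable (Function.uncurry fun (s : ℝ) (q : ℍ) =>
      ENNReal.ofReal (s ^ 2)⁻¹ * (g (‖q‖ * (Real.sqrt s)⁻¹) * ENNReal.ofReal (‖q‖ ^ 2 / s) *
        Φ (‖q‖ ^ 2) * k (ksVec q))) := by
    refine (ENNReal.measurable_ofReal.comp (measurable_fst.pow_const 2).inv).mul ?_
    refine (((hg.comp (measurable_snd.norm.mul (measurable_fst.sqrt.inv))).mul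
      (ENNReal.measurable_ofReal.comp ((measurable_snd.norm.pow_const 2).div measurable_fst))).mul
      (hΦ.comp (measurable_snd.norm.pow_const 2))).mul ?_
    exact hk.comp (continuous_ksVec.measurable.comp measurable_snd)
  rw [lintegral_lintegral_swap hK.aemeasurable]
  -- (vi) the `s`-integral for fixed `q ≠ 0`
  have step6 : ∀ q : ℍ, q ≠ 0 →
      ∫⁻ s in Ioi (0 : ℝ), ENNReal.ofReal (s ^ 2)⁻¹ * (g (‖q‖ * (Real.sqrt s)⁻¹) *
        ENNReal.ofReal (‖q‖ ^ 2 / s) * Φ (‖q‖ ^ 2) * k (ksVec q)) =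
        ksRadialConst g * (Φ (‖q‖ ^ 2) * k (ksVec q) * ENNReal.ofReal (‖q‖ ^ 2)⁻¹) := by
    intro q hq
    have ha : 0 < ‖q‖ := norm_pos_iff.mpr hq
    have ha2 : 0 < ‖q‖ ^ 2 := by positivity
    have hσm : Measurable fun σ : ℝ => ENNReal.ofReal (σ ^ 3)⁻¹ * g (Real.sqrt σ)⁻¹ :=
      (ENNReal.measurable_ofReal.comp (measurable_id.pow_const 3).inv).mul (hg.comp measurable_id.sqrt.inv)
    rw [lintegral_Ioi_comp_mul ha2, ksRadialConst, ← lintegral_mul_const _ hσm, ← lintegral_const_mul' _ _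
      ENNReal.ofReal_ne_top]
    refine setLIntegral_congr_fun measurableSet_Ioi fun σ hσ => ?_
    rw [mem_Ioi] at hσ
    have hsq : Real.sqrt (‖q‖ ^ 2 * σ) = ‖q‖ * Real.sqrt σ := by
      rw [Real.sqrt_mul (sq_nonneg _), Real.sqrt_sq ha.le]
    have hσ0 : Real.sqrt σ ≠ 0 := (Real.sqrt_pos.mpr hσ).ne'
    rw [hsq, mul_inv, ← mul_assoc ‖q‖, mul_inv_cancel₀ ha.ne', one_mul]
    -- collect the `ofReal` factors
    have e1 : ENNReal.ofReal (‖q‖ ^ 2) * (ENNReal.ofReal ((‖q‖ ^ 2 * σ) ^ 2)⁻¹ *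
        (g (Real.sqrt σ)⁻¹ * ENNReal.ofReal (‖q‖ ^ 2 / (‖q‖ ^ 2 * σ)) * Φ (‖q‖ ^ 2) * k (ksVec q))) =
        ENNReal.ofReal (σ ^ 3)⁻¹ * g (Real.sqrt σ)⁻¹ * (Φ (‖q‖ ^ 2) * k (ksVec q) * ENNReal.ofReal (‖q‖ ^ 2)⁻¹) := by
      have e2 : ENNReal.ofReal (‖q‖ ^ 2) * ENNReal.ofReal ((‖q‖ ^ 2 * σ) ^ 2)⁻¹ *
          ENNReal.ofReal (‖q‖ ^ 2 / (‖q‖ ^ 2 * σ)) = ENNReal.ofReal (σ ^ 3)⁻¹ * ENNReal.ofReal (‖q‖ ^ 2)⁻¹ := by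
        rw [← ENNReal.ofReal_mul (by positivity), ← ENNReal.ofReal_mul (by positivity),
          ← ENNReal.ofReal_mul (by positivity)]
        congr 1
        field_simp
      calc _ = ENNReal.ofReal (‖q‖ ^ 2) * ENNReal.ofReal ((‖q‖ ^ 2 * σ) ^ 2)⁻¹ *
            ENNReal.ofReal (‖q‖ ^ 2 / (‖q‖ ^ 2 * σ)) * (g (Real.sqrt σ)⁻¹ * (Φ (‖q‖ ^ 2) * k (ksVec q))) := by
            ring
        _ = _ := by rw [e2]; ring
    exact e1
  rw [lintegral_congr_ae (hae.mono fun q hq => step6 q hq)]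
  -- (vii) the KS identity
  have hL : Measurable fun q : ℍ => Φ (‖q‖ ^ 2) * k (ksVec q) * ENNReal.ofReal (‖q‖ ^ 2)⁻¹ :=
    ((hΦ.comp (measurable_norm.pow_const 2)).mul (hk.comp continuous_ksVec.measurable)).mul
      (ENNReal.measurable_ofReal.comp (measurable_norm.pow_const 2).inv)
  rw [lintegral_const_mul _ hL]
  have hFm : Measurable fun x : ℝ³ => Φ ‖x‖ * k x * ENNReal.ofReal ‖x‖⁻¹ :=
    ((hΦ.comp measurable_norm).mul hk).mul (ENNReal.measurable_ofReal.comp measurable_norm.inv)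
  have h7 : ∀ q : ℍ, Φ (‖q‖ ^ 2) * k (ksVec q) * ENNReal.ofReal (‖q‖ ^ 2)⁻¹ =
      (fun x : ℝ³ => Φ ‖x‖ * k x * ENNReal.ofReal ‖x‖⁻¹) (ksVec q) := by
    intro q; simp only [norm_ksVec]
  simp_rw [h7]
  rw [lintegral_comp_ksVec _ hFm, ← mul_assoc, mul_comm (ksRadialConst g)]
  congr 1
  refine lintegral_congr fun x => ?_
  -- `ofReal(|x|⁻¹) · (ofReal |x|)⁻¹ = ofReal(|x|⁻²)` (both sides `0` at `x = 0`)
  show Φ ‖x‖ * k x * ENNReal.ofReal ‖x‖⁻¹ * (ENNReal.ofReal ‖x‖)⁻¹ = k x * Φ ‖x‖ * ENNReal.ofReal (‖x‖ ^ 2)⁻¹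
  by_cases hx : x = 0
  · subst hx; simp
  have hxn : 0 < ‖x‖ := norm_pos_iff.mpr hx
  rw [← ENNReal.ofReal_inv_of_pos hxn, mul_assoc, ← ENNReal.ofReal_mul (by positivity), mul_comm (Φ _) (k x)]
  congr 2
  rw [sq, mul_inv]

end KSQuat
end Literature.Analysis.FluidPDE.Tao2016
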